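import Summits.QuantumFields.BalabanUV.Beta.D1BFx.PackedColumnTableMass
import Summits.QuantumFields.BalabanUV.Beta.D1BFx.PackedNSideReadout
import Summits.QuantumFields.BalabanUV.Beta.D1BFx.RestKernelSandwichLoc
import Summits.QuantumFields.BalabanUV.Beta.D1BFx.PackedCoframeMassRoad
import Summits.QuantumFields.BalabanUV.Beta.D1BFx.RestKernelFPUnit
import Summits.QuantumFields.BalabanUV.Beta.AxialDressingRootedBmHessian

/-!
# `BalabanUV.Beta.D1BFx.PackedRoadTableRows` — road «BF-x» for binder row D1, slot (K): **«TABLE ROWS AT THE ROAD» — THE BLOCK-MASS LETTERS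
# `hWs ∕ hWm` OF THE ROAD's PACKED SECOND TABLES `W2NInf m a (r (m+1)) (S₂ (m+1)) μ 0 ν z` (the OWNER's PART 12b ∕ 13 display them, with ONE m-uniform
# `mW κV`, as HYPOTHESES) FROM THE LITERAL's PAIR-STENCIL SOCKET + A BLOCK-SCALE RATE FLOOR + ONE UNITS INEQUALITY, AND ONE LETTER ABOUT THE ROAD's OWN
# CO-FRAME PAIR TABLE** — the W-half twin of «JET ROWS AT THE ROAD» `PackedRoadJetRows` (RULING ρ-g19-1 (L2): «leaf-01 keeps (L1)(L2)'s packaging»),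
# through gan24-leaf-05's «G0-TABLE-MASS» AT THE BLOCK-SCALE RATE `PackedColumnTableMass.mass_blk_vertex2OfK_G₀_le_blockRate` (v1.1 §2′) BY NAME.

HONEST DEPENDENCY (cell records, verbatim): «continuum YM on T⁴ ⇐ BetaPertH ∧ nine spine estimates (0/9 proved); BetaPertH ⇐ (D1) ∧ (D4) ∧
CAP+tail; G-an2-4 gates asym, D1 and NE2/3/4.»  HONEST FRAMING (cell contract, verbatim): «discharging `BetaPertH` makes Bałaban's UV stability
UNCONDITIONAL — a real constructive-QFT result; it is NOT the continuum limit and NOT the Clay problem.»  THIS MODULE DISCHARGES NOTHING of the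
wall: [folklore] `ℓ¹` bookkeeping — leaf-03's `W2NInf = twistR (W2litInf) + embFF (cofPairInf …)` read block by block (the sign twist costs no mass, the
co-frame table sits in the ff block — leaf-03's M3 readers), `W2litInf = vertex2OfK G₀ (m+1) S₂` (PART 3a's `vertex2OfK_eq_sliceSum` under the socket),
gan24-leaf-05's block-rate table lemma, leaf-01's body-mass letter, leaf-04's `Zl_coarse_rate_le`.  The two INPUT letters are
HYPOTHESES: the literal's pair socket + units line is d1-p3 ∕ an2's (J1) data, and **the m-uniform co-frame table letter is the road's OPEN analytic (II)-row
«TB4-W CO-FRAME TABLE, m-UNIFORM MASS» (OWNER W-d1p2-g19-5; count: gan24-leaf-05 (β)(α)(γ)(δ) ∕ leaf-03 (δ) on `n = Lc^k`)** — displayed here in EXACTLY the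
ruling's target shape; per scale it is leaf-03's M2∕M3.  No definition, no `def … : Prop`, no notation, nothing cited, 0 sorry.  0 root-level binders of
row D1 discharged (hW ∕ hR-sockets ∕ hSX-socket ∕ D1Tel ∕ D1Rep — 0); (K) NOT closed; NOT D1, NOT `BetaPertH`, NOT continuum, NOT Clay.

ABSOLUTE RULE (cell charter, verbatim): «No internally-minted statement may enter as a cited fact. Every hypothesis is either kernel-proved in
this package or a verbatim quotation of a PUBLISHED theorem with page reference. The manuscript(s) under audit are NOT citable for their own
disputed steps — they are the thing under adjudication; programme-internal (2001/route/tribunal) claims are never citable.»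

CONTENT (all [folklore] ∕ [our object] read-outs).
* §1 `abs_blk_W2NInf_le` (every block entry of `W2NInf` dominated by literal + embedded co-frame — leaf-03's M3 readers `PackedCoframeMassRoad.blk_W2NInf_inl ∕ _inr`
  BY NAME), `Zl_blockRate_le` (`Zl 4 (δ₀∕n∕2)·(n⁴)⁻¹ ≤ (1 + 4∕δ₀)⁴`), `road_tableRate_pos`.
* §2 **`road_table_mass_le (m) (hr)`** — ONE SCALE: from the literal's pair socket `BiLoc (S₂ κ u κ′ u′) u u (Ck·e^{−δ₂|u′−u|₁}) δ₂` with a block-scale floor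
  `δ₀∕(m+1) ≤ δ₂` and units `16·Ck·Zl 4 (δ₂∕2)² ≤ uT`, and the co-frame letter `Σ'|blk (embFF (cofPairInf …(colH G₀ μ 0) (colH G₀ ν z))) j i| ≤ mC j i·e^{−κc|z|₁}`:
  `Σ'|blk (W2NInf m a r S₂ μ 0 ν z) j i| ≤ (16·C_{G₀}²·(1+16∕κ′)⁴·(1+4∕δ₀)⁴·uT + mC j i)·e^{−min (κ′∕8) (min (δ₀∕2) κc)·|z|₁}` (summable).
* §3 **`road_table_rows`** — the road's families at every `m ≥ 1`: EXACTLY 12b's `hWs`∕`hWm` integrands with the n-FREE `κV := min (κ′∕8) (min (δ₀∕2) κc)` and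
  `mW j i := 16·C_{G₀}²·(1+16∕κ′)⁴·(1+4∕δ₀)⁴·uT + mC j i`, from the socket `hS₂ : ∀ n ≥ 2, …`, the floor `∀ n ≥ 2, δ₀∕n ≤ δ₂ n`, the units line `∀ n ≥ 2, 16·Ck n·Zl 4 (δ₂ n∕2)² ≤ uT`
  and the co-frame letter at every `m ≥ 1`.
NOT HERE (honest): the co-frame letter itself (leaf-03 ∕ gan24-leaf-05); the V half (`PackedRoadJetRows`); the END; `TshotOf`.
Unit `b2b-balaban-beta-d1-formalise-leaf-01` (gen 24), D1 formalisation swarm leaf prover 01, road «BF-x»; INTENT «TABLE ROWS AT THE ROAD» (journal).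
-/

noncomputable section

open Finset
open scoped BigOperators
open Literature.MathematicalPhysics.QuantumFieldTheory.Balaban1983to89
open Literature.MathematicalPhysics.QuantumFieldTheory.Balaban1983to89.Beta
open B12Sec2to5 (l1 l1_nonneg)
open B5Hk163Strip (kappa163 kappa163_pos)
open B5Hk163Decay (MG163)
open B4TorusKernel (periodConst)
open ExpKernelCalculus (Site MKer BiLoc Decays Zl Zl_nonneg l1_sub_symm)
open OneStepResolventKernel (Fib)
open OneStepKernelFamily (KInvStep colH)
open SecondOrderResponse (vertex2OfK)
open AffineAveraging (box toSite)
open Summit.QuantumFields.BalabanUV.Beta.AxialDressingRooted (coDressKBmAt decays_coDressKBmAt_KInvStep)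
open Summit.QuantumFields.BalabanUV.Beta.D1BFx.PackedKernelSplit (blk)
open Summit.QuantumFields.BalabanUV.Beta.D1BFx.PackedSortedBridges (embFF twistR twistR_inl twistR_inr embFF_inl_inl embFF_inl_inr embFF_inr_inl embFF_inr_inr)
open Summit.QuantumFields.BalabanUV.Beta.D1BFx.PackedLettersAtSites (vertex2OfK_eq_sliceSum)
open Summit.QuantumFields.BalabanUV.Beta.D1BFx.PackedColumnEnvelope (colH_G₀_road_weight_nonneg)
open Summit.QuantumFields.BalabanUV.Beta.D1BFx.PackedColumnTableMass (mass_blk_vertex2OfK_G₀_le_blockRate)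
open Summit.QuantumFields.BalabanUV.Beta.D1BFx.RestKernelSandwichLoc (mass_blk_le_of_body)
open Summit.QuantumFields.BalabanUV.Beta.D1BFx.RestKernelFPUnit (Zl_coarse_rate_le)
open Summit.QuantumFields.BalabanUV.Beta.D1BFx.PackedCoframeMassRoad (blk_W2NInf_inl blk_W2NInf_inr)
open Summit.QuantumFields.BalabanUV.Beta.D1BFx.PackedCoframePairLimit (cofPairInf)
open Summit.QuantumFields.BalabanUV.Beta.D1BFx.PackedNSidePair (W2litInf W2NInf)
open Summit.QuantumFields.BalabanUV.Beta.D1BFx.GhostStencil (l1_zero)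

namespace Summit.QuantumFields.BalabanUV.Beta.D1BFx.PackedRoadTableRows

/-! ## §1 The blocks of `W2NInf = twistR (W2litInf) + embFF (cofPairInf …)`; one arithmetic letter -/

section Blocks

variable (m : ℕ) (a : ℝ) (r : Fin (3 + 1) → ℕ) (S₂ : Fin 4 → (Fin 4 → ℤ) → Fin 4 → (Fin 4 → ℤ) → MKer 4 (Fib 3))

/-- [our object] **EVERY BLOCK ENTRY OF `W2NInf` IS DOMINATED** by the literal block entry plus the embedded co-frame block entry (equality on field
columns, the co-frame block vanishing on multiplier columns). -/
theorem abs_blk_W2NInf_le (μ : Fin 4) (y : Fin 4 → ℤ) (ν : Fin 4) (y' : Fin 4 → ℤ) (j i : Bool) (x z : Site 4) (g f : Fin 4) :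
    |blk (W2NInf m a r S₂ μ y ν y') j i x z g f|
      ≤ |blk (W2litInf m r S₂ μ y ν y') j i x z g f|
        + |blk (embFF (cofPairInf (m + 1) a (colH (coDressKBmAt (toSite r) (m + 1) (KInvStep (d := 3) (m + 1) 0)) (m + 1) μ y)
            (colH (coDressKBmAt (toSite r) (m + 1) (KInvStep (d := 3) (m + 1) 0)) (m + 1) ν y'))) j i x z g f| := by
  cases i
  · rw [blk_W2NInf_inr, Pi.neg_apply, Pi.neg_apply, Pi.neg_apply, Pi.neg_apply, abs_neg]
    exact le_add_of_nonneg_right (abs_nonneg _)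
  · rw [blk_W2NInf_inl, Pi.add_apply, Pi.add_apply, Pi.add_apply, Pi.add_apply]
    exact abs_add_le _ _

end Blocks

section Arith

/-- [folklore] **THE BLOCK-RATE LATTICE CONSTANT IS UNIT CLASS**: `Zl 4 (δ₀∕n∕2)·(n⁴)⁻¹ ≤ (1 + 4∕δ₀)⁴` (`n = m+1`; leaf-04's `Zl_coarse_rate_le` at `c = 2`). -/
theorem Zl_blockRate_le (m : ℕ) {δ₀ : ℝ} (hδ₀ : 0 < δ₀) :
    Zl 4 (δ₀ / ((m + 1 : ℕ) : ℝ) / 2) * ((((m + 1 : ℕ) : ℝ)) ^ 4)⁻¹ ≤ (1 + 4 / δ₀) ^ 4 := by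
  haveI : NeZero (m + 1) := ⟨Nat.succ_ne_zero m⟩
  have hn0 : (0 : ℝ) < ((m + 1 : ℕ) : ℝ) := by exact_mod_cast Nat.succ_pos m
  have hn4 : (0 : ℝ) < (((m + 1 : ℕ) : ℝ)) ^ 4 := by positivity
  have h := Zl_coarse_rate_le (n := m + 1) (δ₀ := δ₀) (c := 2) hδ₀ two_pos
  have e : δ₀ / ((m + 1 : ℕ) : ℝ) / 2 = δ₀ / (2 * ((m + 1 : ℕ) : ℝ)) := by rw [div_div, mul_comm]
  have e4 : (1 : ℝ) + 2 * 2 / δ₀ = 1 + 4 / δ₀ := by norm_num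
  rw [e, ← e4]
  rw [mul_inv_le_iff₀ hn4]
  linarith [h]

/-- [folklore] The merged n-free table rate is positive: `0 < min (κ′∕8) (min (δ₀∕2) κc)` for `0 < δ₀`, `0 < κc` (12b's `hκV`). -/
theorem road_tableRate_pos {δ₀ κc : ℝ} (hδ₀ : 0 < δ₀) (hκc : 0 < κc) : 0 < min (kappa163 4 / 4 / 8) (min (δ₀ / 2) κc) :=
  lt_min (by have := kappa163_pos 4; positivity) (lt_min (half_pos hδ₀) hκc)

end Arith

/-! ## §2 One scale: the road's second-table blocks from the literal's socket and the co-frame letter -/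

section Road
set_option maxHeartbeats 400000 in
/-- [folklore] **ONE SCALE.**  For an in-block root `r`, a pair-stencil family `S₂` with the literal's socket `BiLoc (S₂ κ u κ′ u′) u u (Ck·e^{−δ₂|u′−u|₁}) δ₂`
(`0 ≤ Ck`, `0 < δ₂`), a block-scale floor `δ₀∕(m+1) ≤ δ₂` (`0 < δ₀`), ONE units inequality `16·Ck·Zl 4 (δ₂∕2)² ≤ uT`, and the co-frame table letter at the
base bond `(μ, 0)` — `Σ'|blk (embFF (cofPairInf (m+1) a (colH G₀ μ 0) (colH G₀ ν z))) j i| ≤ mC j i·e^{−κc|z|₁}` — every block of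
`W2NInf m a r S₂ μ 0 ν z` has summable plain mass `≤ (16·C_{G₀}²·(1+16∕κ′)⁴·(1+4∕δ₀)⁴·uT + mC j i)·e^{−min (κ′∕8) (min (δ₀∕2) κc)·|z|₁}`. -/
theorem road_table_mass_le (m : ℕ) {a : ℝ} {r : Fin (3 + 1) → ℕ} (hr : r ∈ box (3 + 1) (m + 1))
    {S₂ : Fin 4 → (Fin 4 → ℤ) → Fin 4 → (Fin 4 → ℤ) → MKer 4 (Fib 3)} {Ck δ₂ : ℝ}
    (hS₂ : ∀ κ u κ' u', BiLoc (S₂ κ u κ' u') u u (Ck * Real.exp (-δ₂ * l1 (u' - u))) δ₂) (hCk : 0 ≤ Ck) (hδ₂ : 0 < δ₂)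
    {δ₀ : ℝ} (hδ₀ : 0 < δ₀) (hδ₀₂ : δ₀ / ((m + 1 : ℕ) : ℝ) ≤ δ₂) {uT : ℝ} (huT : 16 * Ck * Zl 4 (δ₂ / 2) ^ 2 ≤ uT)
    {μ ν : Fin 4} {mC : Bool → Bool → ℝ} {κc : ℝ}
    (hCs : ∀ (z : Site 4) (j i : Bool), Summable fun q : Site 4 × Site 4 => ∑ g, ∑ f,
      |blk (embFF (cofPairInf (m + 1) a (colH (coDressKBmAt (toSite r) (m + 1) (KInvStep (d := 3) (m + 1) 0)) (m + 1) μ 0)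
        (colH (coDressKBmAt (toSite r) (m + 1) (KInvStep (d := 3) (m + 1) 0)) (m + 1) ν z))) j i q.1 q.2 g f|)
    (hCm : ∀ (z : Site 4) (j i : Bool), ∑' q : Site 4 × Site 4, ∑ g, ∑ f,
      |blk (embFF (cofPairInf (m + 1) a (colH (coDressKBmAt (toSite r) (m + 1) (KInvStep (d := 3) (m + 1) 0)) (m + 1) μ 0)
        (colH (coDressKBmAt (toSite r) (m + 1) (KInvStep (d := 3) (m + 1) 0)) (m + 1) ν z))) j i q.1 q.2 g f| ≤ mC j i * Real.exp (-κc * l1 z))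
    (z : Site 4) (j i : Bool) :
    (Summable fun q : Site 4 × Site 4 => ∑ g, ∑ f, |blk (W2NInf m a r S₂ μ 0 ν z) j i q.1 q.2 g f|) ∧
      ∑' q : Site 4 × Site 4, ∑ g, ∑ f, |blk (W2NInf m a r S₂ μ 0 ν z) j i q.1 q.2 g f|
        ≤ (16 * ((MG163 4 * periodConst (kappa163 4) 3) * (1 + 8 * (1 + Real.exp (kappa163 4 / 4))) * Real.exp (kappa163 4 / 4)) ^ 2
              * (1 + 16 / (kappa163 4 / 4)) ^ 4 * (1 + 4 / δ₀) ^ 4 * uT + mC j i)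
          * Real.exp (-(min (kappa163 4 / 4 / 8) (min (δ₀ / 2) κc)) * l1 z) := by
  have hn0 : (0 : ℝ) < ((m + 1 : ℕ) : ℝ) := by exact_mod_cast Nat.succ_pos m
  have hκ : 0 < kappa163 4 := kappa163_pos 4
  set K₀ : ℝ := (MG163 4 * periodConst (kappa163 4) 3) * (1 + 8 * (1 + Real.exp (kappa163 4 / 4))) * Real.exp (kappa163 4 / 4) with hK₀
  set ρ : ℝ := min (kappa163 4 / 4 / 8) (min (δ₀ / 2) κc) with hρ
  -- the literal table IS `vertex2OfK G₀ n S₂` (PART 3a, under the socket)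
  obtain ⟨δG, CG, hδG, hCG, hG⟩ := decays_coDressKBmAt_KInvStep (d := 3) hr 0
  set δ' : ℝ := min δ₂ δG with hδ'
  have hδ'pos : 0 < δ' := lt_min hδ₂ hδG
  have hS₂' : ∀ κ u κ' u', BiLoc (S₂ κ u κ' u') u u (Ck * Real.exp (-δ' * l1 (u' - u))) δ' := fun κ u κ' u' x w c b =>
    (hS₂ κ u κ' u' x w c b).trans (mul_le_mul (mul_le_mul_of_nonneg_left (Real.exp_le_exp.mpr
      (by nlinarith [l1_nonneg (u' - u), min_le_left δ₂ δG])) hCk)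
      (Real.exp_le_exp.mpr (by nlinarith [l1_nonneg (x - u), l1_nonneg (w - u), min_le_left δ₂ δG])) (Real.exp_pos _).le
      (mul_nonneg hCk (Real.exp_pos _).le))
  have hlit : W2litInf m r S₂ μ 0 ν z
      = vertex2OfK (coDressKBmAt (toSite r) (m + 1) (KInvStep (d := 3) (m + 1) 0)) (m + 1) S₂ μ 0 ν z := by
    rw [vertex2OfK_eq_sliceSum (N := m + 1) hG hCG hS₂' hCk hδ'pos (min_le_right _ _)]; rfl
  -- the literal pair letters at the block-scale rate `δ₀∕n` (from the socket: body mass, floor, units)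
  have huT0 : 0 ≤ uT := le_trans (by have := Zl_nonneg (D := 4) (half_pos hδ₂); positivity) huT
  have hT : ∀ κ u κ' u' (j i : Bool),
      (Summable fun p : Site 4 × Site 4 => ∑ g, ∑ f, |blk (S₂ κ u κ' u') j i p.1 p.2 g f|) ∧
      ∑' p : Site 4 × Site 4, ∑ g, ∑ f, |blk (S₂ κ u κ' u') j i p.1 p.2 g f|
        ≤ (fun (_ _ : Bool) => uT) j i * Real.exp (-(δ₀ / ((m + 1 : ℕ) : ℝ)) * l1 (u' - u)) := by
    intro κ u κ' u' j i
    have h := mass_blk_le_of_body hS₂ hCk hδ₂ κ u κ' u' j i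
    refine ⟨h.1, h.2.trans ?_⟩
    exact mul_le_mul huT (Real.exp_le_exp.mpr (by nlinarith [l1_nonneg (u' - u)])) (Real.exp_pos _).le huT0
  have hV := mass_blk_vertex2OfK_G₀_le_blockRate m hr hδ₀ (fun κ u κ' u' j i => (hT κ u κ' u' j i).1)
    (fun κ u κ' u' j i => (hT κ u κ' u' j i).2) μ 0 ν z j i
  rw [← hlit, sub_zero] at hV
  -- the literal block's bound, constant made n-free, rate merged
  have hK₀0 : 0 ≤ K₀ := by
    have h := colH_G₀_road_weight_nonneg m
    have h1 : (0 : ℝ) < ((((m + 1 : ℕ) : ℝ)) ^ 4)⁻¹ := by positivity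
    exact (mul_nonneg_iff_of_pos_left h1).1 h
  have hA0 : 0 ≤ 16 * K₀ ^ 2 * (1 + 16 / (kappa163 4 / 4)) ^ 4 := by positivity
  have hZ := Zl_blockRate_le m hδ₀
  have hρL : ρ ≤ min (kappa163 4 / 4 / 8) (δ₀ / 2) := le_min (min_le_left _ _) ((min_le_right _ _).trans (min_le_left _ _))
  have hρN : ρ ≤ κc := (min_le_right _ _).trans (min_le_right _ _)
  have eL : Real.exp (-(min (kappa163 4 / 4 / 8) (δ₀ / 2)) * l1 z) ≤ Real.exp (-ρ * l1 z) :=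
    Real.exp_le_exp.mpr (by nlinarith [l1_nonneg z, hρL])
  have bL : ∑' q : Site 4 × Site 4, ∑ g, ∑ f, |blk (W2litInf m r S₂ μ 0 ν z) j i q.1 q.2 g f|
      ≤ 16 * K₀ ^ 2 * (1 + 16 / (kappa163 4 / 4)) ^ 4 * (1 + 4 / δ₀) ^ 4 * uT * Real.exp (-ρ * l1 z) := by
    have h2 := mul_le_mul_of_nonneg_right (mul_le_mul_of_nonneg_left hZ hA0) huT0
    have e1 : 16 * K₀ ^ 2 * (1 + 16 / (kappa163 4 / 4)) ^ 4 * Zl 4 (δ₀ / ((m + 1 : ℕ) : ℝ) / 2) * ((((m + 1 : ℕ) : ℝ)) ^ 4)⁻¹ * uT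
        = 16 * K₀ ^ 2 * (1 + 16 / (kappa163 4 / 4)) ^ 4 * (Zl 4 (δ₀ / ((m + 1 : ℕ) : ℝ) / 2) * ((((m + 1 : ℕ) : ℝ)) ^ 4)⁻¹) * uT := by
      ring
    have h1 : 16 * K₀ ^ 2 * (1 + 16 / (kappa163 4 / 4)) ^ 4 * Zl 4 (δ₀ / ((m + 1 : ℕ) : ℝ) / 2) * ((((m + 1 : ℕ) : ℝ)) ^ 4)⁻¹ * uT
        ≤ 16 * K₀ ^ 2 * (1 + 16 / (kappa163 4 / 4)) ^ 4 * (1 + 4 / δ₀) ^ 4 * uT := by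
      rw [e1]
      exact h2
    exact hV.2.trans (mul_le_mul h1 eL (Real.exp_pos _).le (by positivity))
  -- the co-frame block's bound, rate merged
  have hmC : 0 ≤ mC j i := by
    have h := hCm 0 j i
    rw [l1_zero, mul_zero, Real.exp_zero, mul_one] at h
    exact (tsum_nonneg fun q => Finset.sum_nonneg fun g _ => Finset.sum_nonneg fun f _ => abs_nonneg _).trans h
  have eN : Real.exp (-κc * l1 z) ≤ Real.exp (-ρ * l1 z) := Real.exp_le_exp.mpr (by nlinarith [l1_nonneg z, hρN])
  have bN : ∑' q : Site 4 × Site 4, ∑ g, ∑ f,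
      |blk (embFF (cofPairInf (m + 1) a (colH (coDressKBmAt (toSite r) (m + 1) (KInvStep (d := 3) (m + 1) 0)) (m + 1) μ 0)
        (colH (coDressKBmAt (toSite r) (m + 1) (KInvStep (d := 3) (m + 1) 0)) (m + 1) ν z))) j i q.1 q.2 g f| ≤ mC j i * Real.exp (-ρ * l1 z) :=
    (hCm z j i).trans (mul_le_mul_of_nonneg_left eN hmC)
  -- every block: dominated entrywise by literal + co-frame (`abs_blk_W2NInf_le`), summed
  have hpt : ∀ q : Site 4 × Site 4, ∑ g, ∑ f, |blk (W2NInf m a r S₂ μ 0 ν z) j i q.1 q.2 g f|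
      ≤ (∑ g, ∑ f, |blk (W2litInf m r S₂ μ 0 ν z) j i q.1 q.2 g f|)
        + ∑ g, ∑ f, |blk (embFF (cofPairInf (m + 1) a (colH (coDressKBmAt (toSite r) (m + 1) (KInvStep (d := 3) (m + 1) 0)) (m + 1) μ 0)
            (colH (coDressKBmAt (toSite r) (m + 1) (KInvStep (d := 3) (m + 1) 0)) (m + 1) ν z))) j i q.1 q.2 g f| := fun q => by
    rw [← Finset.sum_add_distrib]
    refine Finset.sum_le_sum fun g _ => ?_
    rw [← Finset.sum_add_distrib]
    exact Finset.sum_le_sum fun f _ => abs_blk_W2NInf_le m a r S₂ μ 0 ν z j i q.1 q.2 g f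
  have h0 : ∀ q : Site 4 × Site 4, 0 ≤ ∑ g, ∑ f, |blk (W2NInf m a r S₂ μ 0 ν z) j i q.1 q.2 g f| := fun q =>
    Finset.sum_nonneg fun g _ => Finset.sum_nonneg fun f _ => abs_nonneg _
  have hsum := hV.1.add (hCs z j i)
  have hs : Summable fun q : Site 4 × Site 4 => ∑ g, ∑ f, |blk (W2NInf m a r S₂ μ 0 ν z) j i q.1 q.2 g f| :=
    Summable.of_nonneg_of_le h0 hpt hsum
  refine ⟨hs, ?_⟩
  calc ∑' q : Site 4 × Site 4, ∑ g, ∑ f, |blk (W2NInf m a r S₂ μ 0 ν z) j i q.1 q.2 g f|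
      ≤ ∑' q : Site 4 × Site 4, ((∑ g, ∑ f, |blk (W2litInf m r S₂ μ 0 ν z) j i q.1 q.2 g f|)
          + ∑ g, ∑ f, |blk (embFF (cofPairInf (m + 1) a (colH (coDressKBmAt (toSite r) (m + 1) (KInvStep (d := 3) (m + 1) 0)) (m + 1) μ 0)
              (colH (coDressKBmAt (toSite r) (m + 1) (KInvStep (d := 3) (m + 1) 0)) (m + 1) ν z))) j i q.1 q.2 g f|) :=
        Summable.tsum_le_tsum hpt hs hsum
    _ = (∑' q : Site 4 × Site 4, ∑ g, ∑ f, |blk (W2litInf m r S₂ μ 0 ν z) j i q.1 q.2 g f|)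
          + ∑' q : Site 4 × Site 4, ∑ g, ∑ f,
              |blk (embFF (cofPairInf (m + 1) a (colH (coDressKBmAt (toSite r) (m + 1) (KInvStep (d := 3) (m + 1) 0)) (m + 1) μ 0)
                (colH (coDressKBmAt (toSite r) (m + 1) (KInvStep (d := 3) (m + 1) 0)) (m + 1) ν z))) j i q.1 q.2 g f| :=
        hV.1.tsum_add (hCs z j i)
    _ ≤ 16 * K₀ ^ 2 * (1 + 16 / (kappa163 4 / 4)) ^ 4 * (1 + 4 / δ₀) ^ 4 * uT * Real.exp (-ρ * l1 z) + mC j i * Real.exp (-ρ * l1 z) :=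
        add_le_add bL bN
    _ = _ := by ring

/-- [folklore] **«TABLE ROWS AT THE ROAD»** — the road's per-scale families `r n`, `S₂ n` at every `m ≥ 1`: from 12b's OWN pair socket
`hS₂ : ∀ n ≥ 2, BiLoc (S₂ n κ u κ′ u′) u u (Ck n·e^{−δ₂ n|u′−u|₁}) (δ₂ n)`, a block-scale floor `∀ n ≥ 2, δ₀∕n ≤ δ₂ n` and ONE units inequality
`∀ n ≥ 2, 16·Ck n·Zl 4 (δ₂ n∕2)² ≤ uT` (the literal's (II)-row, displayed), and the co-frame table letter at every `m ≥ 1` (the road's OPEN (II)-row «TB4-W CO-FRAME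
TABLE, m-UNIFORM MASS», displayed in the ruling's target shape): EXACTLY 12b∕13's binders `hWs`∕`hWm` (restricted to `m ≥ 1`) with the n-FREE
`κV := min (κ′∕8) (min (δ₀∕2) κc)` and `mW j i := 16·C_{G₀}²·(1+16∕κ′)⁴·(1+4∕δ₀)⁴·uT + mC j i`. -/
theorem road_table_rows {a : ℝ} {r : ℕ → Fin (3 + 1) → ℕ} (hr : ∀ m : ℕ, r (m + 1) ∈ box (3 + 1) (m + 1))
    {S₂ : ℕ → Fin 4 → (Fin 4 → ℤ) → Fin 4 → (Fin 4 → ℤ) → MKer 4 (Fib 3)} {Ck δ₂ : ℕ → ℝ}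
    (hS₂ : ∀ n : ℕ, 2 ≤ n → ∀ κ u κ' u', BiLoc (S₂ n κ u κ' u') u u (Ck n * Real.exp (-δ₂ n * l1 (u' - u))) (δ₂ n))
    (hCk : ∀ n, 0 ≤ Ck n) (hδ₂ : ∀ n, 0 < δ₂ n)
    {δ₀ : ℝ} (hδ₀ : 0 < δ₀) (hδ₀₂ : ∀ n : ℕ, 2 ≤ n → δ₀ / (n : ℝ) ≤ δ₂ n) {uT : ℝ} (huT : ∀ n : ℕ, 2 ≤ n → 16 * Ck n * Zl 4 (δ₂ n / 2) ^ 2 ≤ uT)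
    {μ ν : Fin 4} {mC : Bool → Bool → ℝ} {κc : ℝ}
    (hCs : ∀ (m : ℕ), 1 ≤ m → ∀ (z : Site 4) (j i : Bool), Summable fun q : Site 4 × Site 4 => ∑ g, ∑ f,
      |blk (embFF (cofPairInf (m + 1) a (colH (coDressKBmAt (toSite (r (m + 1))) (m + 1) (KInvStep (d := 3) (m + 1) 0)) (m + 1) μ 0)
        (colH (coDressKBmAt (toSite (r (m + 1))) (m + 1) (KInvStep (d := 3) (m + 1) 0)) (m + 1) ν z))) j i q.1 q.2 g f|)
    (hCm : ∀ (m : ℕ), 1 ≤ m → ∀ (z : Site 4) (j i : Bool), ∑' q : Site 4 × Site 4, ∑ g, ∑ f,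
      |blk (embFF (cofPairInf (m + 1) a (colH (coDressKBmAt (toSite (r (m + 1))) (m + 1) (KInvStep (d := 3) (m + 1) 0)) (m + 1) μ 0)
        (colH (coDressKBmAt (toSite (r (m + 1))) (m + 1) (KInvStep (d := 3) (m + 1) 0)) (m + 1) ν z))) j i q.1 q.2 g f|
        ≤ mC j i * Real.exp (-κc * l1 z)) :
    (∀ (m : ℕ), 1 ≤ m → ∀ (z : Site 4) (j i : Bool), Summable fun q : Site 4 × Site 4 => ∑ g, ∑ f,
      |blk (W2NInf m a (r (m + 1)) (S₂ (m + 1)) μ 0 ν z) j i q.1 q.2 g f|) ∧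
    (∀ (m : ℕ), 1 ≤ m → ∀ (z : Site 4) (j i : Bool), ∑' q : Site 4 × Site 4, ∑ g, ∑ f,
      |blk (W2NInf m a (r (m + 1)) (S₂ (m + 1)) μ 0 ν z) j i q.1 q.2 g f|
      ≤ (16 * ((MG163 4 * periodConst (kappa163 4) 3) * (1 + 8 * (1 + Real.exp (kappa163 4 / 4))) * Real.exp (kappa163 4 / 4)) ^ 2
            * (1 + 16 / (kappa163 4 / 4)) ^ 4 * (1 + 4 / δ₀) ^ 4 * uT + mC j i)
        * Real.exp (-(min (kappa163 4 / 4 / 8) (min (δ₀ / 2) κc)) * l1 z)) := by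
  have h : ∀ (m : ℕ), 1 ≤ m → ∀ (z : Site 4) (j i : Bool), _ := fun m hm z j i => by
    have hn : 2 ≤ m + 1 := by omega
    exact road_table_mass_le m (hr m) (hS₂ (m + 1) hn) (hCk (m + 1)) (hδ₂ (m + 1)) hδ₀ (hδ₀₂ (m + 1) hn) (huT (m + 1) hn)
      (hCs m hm) (hCm m hm) z j i
  exact ⟨fun m hm z j i => (h m hm z j i).1, fun m hm z j i => (h m hm z j i).2⟩

end Road

end Summit.QuantumFields.BalabanUV.Beta.D1BFx.PackedRoadTableRows

end
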